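import Summits.Ventures.PercRepro.S2BasesTriangles
import Summits.Ventures.PercRepro.S2TopFiveHit
import Summits.Ventures.PercRepro.S2ThreeSetCounts

/-!
# PercRepro — S2: THE SPANNING SETS AGAINST THREE CIRCUITS, AND THE TOP `5`-SETS ABOVE A TRIANGLE (p7, gen 16; sub-claim S2)

**`ncard_spanning_add_le_of_three_circuits`**: the spanning `p`-sets of a core of rank `p` on `n = p + d` points are bases, hence
contain none of three distinct circuits `C₁ C₂ C₃` (`|C_i| ≤ p`, `|C_i ∪ C_j| ≤ p`): by Bonferroni
`#spanning + Σ_i C(n − |C_i|, d) ≤ Σ_{m<d} C(n, m) + C(n, p) + Σ_{i<j} C(n − |C_i ∪ C_j|, d)` — the three-triangle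
lemma `S2.ncard_spanning_add_le_of_three_triangles` for circuits of any size (the same proof).
**`ncard_top_five_add_le_of_two_meeting_triangles`**: when two triangles `T₁ T₂` meet, every `5`-superset of either meets
both, so the top `5`-sets (independent, hence above neither) and the `≥ 239` supersets sit disjointly in any family of
`5`-sets meeting two of three sets `T₁ T₂ Y₃`. Nothing about any cell is claimed. Axioms: standard.
-/

open scoped Matroid

namespace PercRepro

namespace S2

open Set

variable {α : Type}

/-- **The spanning sets of a core against three distinct circuits** (Bonferroni on the `p`-sets above them). -/
theorem ncard_spanning_add_le_of_three_circuits (M : Matroid α) [M.Finite] {p d : ℕ}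
    (hR : M.eRank = (p : ℕ∞)) (hn : M.E.ncard = p + d)
    {C₁ C₂ C₃ : Set α} (h₁ : M.IsCircuit C₁) (h₂ : M.IsCircuit C₂) (h₃ : M.IsCircuit C₃)
    (hc₁ : C₁.ncard ≤ p) (hc₂ : C₂.ncard ≤ p) (hc₃ : C₃.ncard ≤ p)
    (hu₁₂ : (C₁ ∪ C₂).ncard ≤ p) (hu₁₃ : (C₁ ∪ C₃).ncard ≤ p) (hu₂₃ : (C₂ ∪ C₃).ncard ≤ p) :
    {X : Set α | X ⊆ M.E ∧ M.eRk X = M.eRank}.ncard +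
      (p + d - C₁.ncard).choose d + (p + d - C₂.ncard).choose d + (p + d - C₃.ncard).choose d ≤
      ∑ m ∈ Finset.range d, (p + d).choose m + (p + d).choose p +
        (p + d - (C₁ ∪ C₂).ncard).choose d + (p + d - (C₁ ∪ C₃).ncard).choose d +
        (p + d - (C₂ ∪ C₃).ncard).choose d := by
  classical
  have hd : M.E.encard = M.eRank + d := by
    rw [hR, ← M.ground_finite.cast_ncard_eq, hn]
    push_cast
    ring
  -- (b) the spanning sets size by size through their complements
  have h1 := ncard_spanning_le_sum_compl M hd
  rw [Finset.sum_range_succ] at h1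
  -- (c) the complements of `< d` points
  have hsmall : ∑ m ∈ Finset.range d, {B : Set α | B ⊆ M.E ∧ B.ncard = m ∧ M.eRk (M.E \ B) = M.eRank}.ncard ≤
      ∑ m ∈ Finset.range d, (p + d).choose m := by
    refine Finset.sum_le_sum (fun m _ => ?_)
    calc {B : Set α | B ⊆ M.E ∧ B.ncard = m ∧ M.eRk (M.E \ B) = M.eRank}.ncard
        ≤ {B : Set α | B ⊆ M.E ∧ B.ncard = m}.ncard :=
          Set.ncard_le_ncard (fun B hB => ⟨hB.1, hB.2.1⟩)
            (M.ground_finite.finite_subsets.subset (fun B hB => hB.1))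
      _ = (p + d).choose m := by rw [ncard_subsets_ncard_eq M.E M.ground_finite m, hn]
  -- (d) the complements of exactly `d` points are the spanning `p`-sets
  set Sp := {X : Set α | X ⊆ M.E ∧ X.ncard = p ∧ M.eRk X = M.eRank} with hSp
  have hSpfin : Sp.Finite := M.ground_finite.finite_subsets.subset (fun X hX => hX.1)
  have hlast : {B : Set α | B ⊆ M.E ∧ B.ncard = d ∧ M.eRk (M.E \ B) = M.eRank}.ncard ≤ Sp.ncard := by
    have hmaps : ∀ B ∈ {B : Set α | B ⊆ M.E ∧ B.ncard = d ∧ M.eRk (M.E \ B) = M.eRank},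
        (fun B : Set α => M.E \ B) B ∈ Sp := by
      rintro B ⟨hBE, hBd, hBs⟩
      refine ⟨Set.sdiff_subset, ?_, hBs⟩
      rw [Set.ncard_sdiff hBE (M.ground_finite.subset hBE), hn, hBd]
      omega
    have hinj : Set.InjOn (fun B : Set α => M.E \ B)
        {B : Set α | B ⊆ M.E ∧ B.ncard = d ∧ M.eRk (M.E \ B) = M.eRank} := by
      intro X hX Y hY hXY
      simp only at hXY
      rw [← Set.sdiff_sdiff_cancel_left hX.1, hXY, Set.sdiff_sdiff_cancel_left hY.1]
    exact Set.ncard_le_ncard_of_injOn _ hmaps hinj hSpfin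
  -- (e) the spanning `p`-sets avoid the three circuits
  set P := {X : Set α | X ⊆ M.E ∧ X.ncard = p} with hP
  have hPfin : P.Finite := M.ground_finite.finite_subsets.subset (fun X hX => hX.1)
  have hPcard : P.ncard = (p + d).choose p := by rw [hP, ncard_subsets_ncard_eq M.E M.ground_finite p, hn]
  let S : Set α → Set (Set α) := fun T => {X : Set α | X ⊆ M.E ∧ X.ncard = p ∧ T ⊆ X}
  have hSsub : ∀ T, S T ⊆ P := fun T X hX => ⟨hX.1, hX.2.1⟩
  have hSfin : ∀ T, (S T).Finite := fun T => hPfin.subset (hSsub T)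
  have hdep : ∀ {T : Set α}, M.IsCircuit T → ∀ X ∈ Sp, ¬ T ⊆ X := by
    intro T hT X hX hTX
    have hXfin : X.Finite := M.ground_finite.subset hX.1
    have hD : M.Dep X := hT.dep.superset hTX hX.1
    have hlt := Matroid.eRk_lt_encard_of_dep_of_finite hXfin hD
    rw [hX.2.2, hR, ← hXfin.cast_ncard_eq, hX.2.1] at hlt
    exact lt_irrefl _ hlt
  have hUfin : (S C₁ ∪ S C₂ ∪ S C₃).Finite := ((hSfin C₁).union (hSfin C₂)).union (hSfin C₃)
  have hdisj : Disjoint Sp (S C₁ ∪ S C₂ ∪ S C₃) := by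
    rw [Set.disjoint_left]
    intro X hX hXU
    rcases hXU with (hX1 | hX2) | hX3
    · exact hdep h₁ X hX hX1.2.2
    · exact hdep h₂ X hX hX2.2.2
    · exact hdep h₃ X hX hX3.2.2
  -- (f) `#Sp + #U ≤ #P`
  have hSpU : Sp.ncard + (S C₁ ∪ S C₂ ∪ S C₃).ncard ≤ P.ncard := by
    rw [← Set.ncard_union_eq hdisj hSpfin hUfin]
    refine Set.ncard_le_ncard ?_ hPfin
    rintro X (hX | hX)
    · exact ⟨hX.1, hX.2.1⟩
    · rcases hX with (h | h) | h
      · exact hSsub _ h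
      · exact hSsub _ h
      · exact hSsub _ h
  -- (g) Bonferroni
  have hB1 := Set.ncard_union_add_ncard_inter (S C₁) (S C₂) (hSfin C₁) (hSfin C₂)
  have hB2 := Set.ncard_union_add_ncard_inter (S C₁ ∪ S C₂) (S C₃) ((hSfin C₁).union (hSfin C₂)) (hSfin C₃)
  have hB3 : ((S C₁ ∪ S C₂) ∩ S C₃).ncard ≤ (S C₁ ∩ S C₃).ncard + (S C₂ ∩ S C₃).ncard := by
    rw [Set.union_inter_distrib_right]
    exact Set.ncard_union_le _ _
  -- (h) each `S Cᵢ` has `≥ C(n − |Cᵢ|, d)` members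
  have hlow : ∀ {T : Set α}, M.IsCircuit T → T.ncard ≤ p → (p + d - T.ncard).choose d ≤ (S T).ncard := by
    intro T hT hTc
    have h := choose_le_ncard_subsets_superset M hT.subset_ground p hTc
    rw [hn] at h
    rwa [Nat.choose_symm_of_eq_add (show p + d - T.ncard = (p - T.ncard) + d by omega)] at h
  -- (i) each pair has `≤ C(n − |T ∪ T'|, d)` common members
  have hpair : ∀ {T T' : Set α}, M.IsCircuit T → M.IsCircuit T' → (T ∪ T').ncard ≤ p →
      (S T ∩ S T').ncard ≤ (p + d - (T ∪ T').ncard).choose d := by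
    intro T T' hT hT' hu
    have hsub : S T ∩ S T' ⊆ {X : Set α | X ⊆ M.E ∧ X.ncard = p ∧ T ∪ T' ⊆ X} := by
      rintro X ⟨hX1, hX2⟩
      exact ⟨hX1.1, hX1.2.1, Set.union_subset hX1.2.2 hX2.2.2⟩
    have h := ncard_subsets_superset_le M (Set.union_subset hT.subset_ground hT'.subset_ground) p
    rw [hn] at h
    have hsym : (p + d - (T ∪ T').ncard).choose (p - (T ∪ T').ncard) = (p + d - (T ∪ T').ncard).choose d :=
      Nat.choose_symm_of_eq_add (by omega)
    rw [hsym] at h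
    calc (S T ∩ S T').ncard ≤ {X : Set α | X ⊆ M.E ∧ X.ncard = p ∧ T ∪ T' ⊆ X}.ncard :=
          Set.ncard_le_ncard hsub (hPfin.subset (fun X hX => ⟨hX.1, hX.2.1⟩))
      _ ≤ (p + d - (T ∪ T').ncard).choose d := h
  have hl1 := hlow h₁ hc₁
  have hl2 := hlow h₂ hc₂
  have hl3 := hlow h₃ hc₃
  have hp12 := hpair h₁ h₂ hu₁₂
  have hp13 := hpair h₁ h₃ hu₁₃
  have hp23 := hpair h₂ h₃ hu₂₃
  -- (j) assemble
  rw [hPcard] at hSpU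
  omega

/-- **The top `5`-sets are independent**: a `5`-set of rank `5` contains no circuit. -/
theorem not_subset_of_top_five (M : Matroid α) [M.Finite] {B T : Set α} (hT : M.IsCircuit T)
    (hBE : B ⊆ M.E) (hB5 : B.ncard = 5) (hBr : M.eRk B = 5) : ¬ T ⊆ B := by
  intro hTB
  have hBfin : B.Finite := M.ground_finite.subset hBE
  have hD : M.Dep B := hT.dep.superset hTB hBE
  have hlt := Matroid.eRk_lt_encard_of_dep_of_finite hBfin hD
  rw [hBr, ← hBfin.cast_ncard_eq, hB5] at hlt
  exact lt_irrefl _ (by exact_mod_cast hlt)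

/-- **The top `5`-sets above two meeting triangles**: if `T₁ ∩ T₂ ≠ ∅` then every `5`-superset of `T₁` or `T₂` meets both
`T₁` and `T₂`; the top `5`-sets are above neither, so `#top5 + 239 ≤ #{5-sets meeting two of T₁ T₂ Y}` on `19` points. -/
theorem ncard_top_five_add_le_of_two_meeting_triangles (M : Matroid α) [M.Finite]
    (hn : M.E.ncard = 19) (hC1 : ∀ L ⊆ M.E, M.eRk L = 2 → L.ncard ≤ 3) {T₁ T₂ : Set α} (h₁ : M.IsCircuit T₁) (h₁c : T₁.ncard = 3) (h₂ : M.IsCircuit T₂)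
    (h₂c : T₂.ncard = 3) (hne : T₁ ≠ T₂) (hmeet : (T₁ ∩ T₂).Nonempty) (Y : Set α)
    (hhit : ∀ B ⊆ M.E, B.ncard = 5 → M.eRk (M.E \ B) = M.eRank →
      (((B ∩ T₁).Nonempty ∧ (B ∩ T₂).Nonempty) ∨ ((B ∩ T₁).Nonempty ∧ (B ∩ Y).Nonempty) ∨
        ((B ∩ T₂).Nonempty ∧ (B ∩ Y).Nonempty))) :
    {B : Set α | B ⊆ M.E ∧ B.ncard = 5 ∧ M.eRk B = 5 ∧ M.eRk (M.E \ B) = M.eRank}.ncard + 239 ≤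
      {X : Set α | X ⊆ M.E ∧ X.ncard = 5 ∧
        (((X ∩ T₁).Nonempty ∧ (X ∩ T₂).Nonempty) ∨ ((X ∩ T₁).Nonempty ∧ (X ∩ Y).Nonempty) ∨
          ((X ∩ T₂).Nonempty ∧ (X ∩ Y).Nonempty))}.ncard := by
  classical
  set Fam := {X : Set α | X ⊆ M.E ∧ X.ncard = 5 ∧
    (((X ∩ T₁).Nonempty ∧ (X ∩ T₂).Nonempty) ∨ ((X ∩ T₁).Nonempty ∧ (X ∩ Y).Nonempty) ∨
      ((X ∩ T₂).Nonempty ∧ (X ∩ Y).Nonempty))} with hFam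
  set Top := {B : Set α | B ⊆ M.E ∧ B.ncard = 5 ∧ M.eRk B = 5 ∧ M.eRk (M.E \ B) = M.eRank} with hTop
  let F : Set α → Set (Set α) := fun T => {X : Set α | X ⊆ M.E ∧ X.ncard = 5 ∧ T ⊆ X}
  have hFamfin : Fam.Finite := M.ground_finite.finite_subsets.subset (fun X hX => hX.1)
  have hF1fin : (F T₁).Finite := M.ground_finite.finite_subsets.subset (fun X hX => hX.1)
  have hF2fin : (F T₂).Finite := M.ground_finite.finite_subsets.subset (fun X hX => hX.1)
  have hTopfin : Top.Finite := M.ground_finite.finite_subsets.subset (fun X hX => hX.1)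
  obtain ⟨z, hz₁, hz₂⟩ := hmeet
  -- every superset of `T₁` or `T₂` lies in the family
  have hF1 : F T₁ ⊆ Fam := by
    rintro X ⟨hXE, hX5, hTX⟩
    exact ⟨hXE, hX5, Or.inl ⟨⟨z, hTX hz₁, hz₁⟩, ⟨z, hTX hz₁, hz₂⟩⟩⟩
  have hF2 : F T₂ ⊆ Fam := by
    rintro X ⟨hXE, hX5, hTX⟩
    exact ⟨hXE, hX5, Or.inl ⟨⟨z, hTX hz₂, hz₁⟩, ⟨z, hTX hz₂, hz₂⟩⟩⟩
  -- the top `5`-sets lie in the family, above neither triangle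
  have hTopFam : Top ⊆ Fam := by
    rintro B ⟨hBE, hB5, -, hBs⟩
    exact ⟨hBE, hB5, hhit B hBE hB5 hBs⟩
  have hdisj : Disjoint Top (F T₁ ∪ F T₂) := by
    rw [Set.disjoint_left]
    rintro B ⟨hBE, hB5, hBr, -⟩ (hB | hB)
    · exact not_subset_of_top_five M h₁ hBE hB5 hBr hB.2.2
    · exact not_subset_of_top_five M h₂ hBE hB5 hBr hB.2.2
  have hunion : Top.ncard + (F T₁ ∪ F T₂).ncard ≤ Fam.ncard := by
    rw [← Set.ncard_union_eq hdisj hTopfin (hF1fin.union hF2fin)]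
    exact Set.ncard_le_ncard (Set.union_subset hTopFam (Set.union_subset hF1 hF2)) hFamfin
  -- `≥ 120` supersets each
  have hlow : ∀ {T : Set α}, M.IsCircuit T → T.ncard = 3 → 120 ≤ (F T).ncard := by
    intro T hT hTc
    have h := choose_le_ncard_subsets_superset M hT.subset_ground 5 (by omega)
    rw [hn, hTc] at h
    norm_num [Nat.choose] at h
    exact h
  -- at most one common superset (it would contain the `5` points of `T₁ ∪ T₂`)
  have hu5 : 5 ≤ (T₁ ∪ T₂).ncard := five_le_ncard_union_of_triangles M hC1 h₁ h₁c h₂ h₂c hne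
  have hinter : (F T₁ ∩ F T₂).ncard ≤ 1 := by
    have hsub : F T₁ ∩ F T₂ ⊆ {X : Set α | X ⊆ M.E ∧ X.ncard = 5 ∧ T₁ ∪ T₂ ⊆ X} := by
      rintro X ⟨hX1, hX2⟩
      exact ⟨hX1.1, hX1.2.1, Set.union_subset hX1.2.2 hX2.2.2⟩
    have h := ncard_subsets_superset_le M (Set.union_subset h₁.subset_ground h₂.subset_ground) 5
    rw [hn] at h
    have hle := Set.ncard_le_ncard hsub (M.ground_finite.finite_subsets.subset (fun X hX => hX.1))
    have hch : (19 - (T₁ ∪ T₂).ncard).choose (5 - (T₁ ∪ T₂).ncard) ≤ 1 := by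
      have h0 : 5 - (T₁ ∪ T₂).ncard = 0 := by omega
      rw [h0, Nat.choose_zero_right]
    omega
  have hB := Set.ncard_union_add_ncard_inter (F T₁) (F T₂) hF1fin hF2fin
  have hl1 := hlow h₁ h₁c
  have hl2 := hlow h₂ h₂c
  omega

end S2

end PercRepro
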